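import Summits.KontsevichZagierPeriods.Zeta5Search.LaiSweepShard

/-!
# `κ₃` sweep certificate — shard file 064 of 127 (shards 448–454 of 889)

HONEST FRAMING. Systematic search; no irrationality claim unless certified. This file only checks,
by `decide +kernel`, shards 448–454 of the order-cell sweep of the `κ₃` point `(74, 2180, 444; δ74)`
(engine `LaiSweepEngine`, soundness `LaiSweepJump/Free/Eval/Shard/Kappa3`; a shard is `⟨regime, n,
p, q, p', q', Lo, Up⟩`: `n` cells from `p/q` to `p'/q'` with integer rate sums in `[Lo, Up]`, `K =
128`, `D = 2^40`). It draws NO conclusion: only the capstone `LaiKappa3SweepCert`, which needs all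
127 shard files, does. Kernel cost of this file ≈ 560 cells × 0.3 s.
-/

namespace Summit.KontsevichZagierPeriods.Zeta5Search.Sweep

set_option maxHeartbeats 100000000 in
/-- Shard 448: 80 cells of regime B from `86/193` to `185/414`.
[cite: Lai2024BallRivoal, §4 Lemma 4.3] -/
theorem shard448 :
    Shard.check 128 (2^40)
      ⟨true, 80, 86, 193, 185, 414, 16452315519570, 19269210548408⟩ = true := by
  decide +kernel

set_option maxHeartbeats 100000000 in
/-- Shard 449: 80 cells of regime B from `185/414` to `177/395`.
[cite: Lai2024BallRivoal, §4 Lemma 4.3] -/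
theorem shard449 :
    Shard.check 128 (2^40)
      ⟨true, 80, 185, 414, 177, 395, 16141391709522, 18921609732869⟩ = true := by
  decide +kernel

set_option maxHeartbeats 100000000 in
/-- Shard 450: 80 cells of regime B from `177/395` to `173/385`.
[cite: Lai2024BallRivoal, §4 Lemma 4.3] -/
theorem shard450 :
    Shard.check 128 (2^40)
      ⟨true, 80, 177, 395, 173, 385, 16200377670356, 19007532224775⟩ = true := by
  decide +kernel

set_option maxHeartbeats 100000000 in
/-- Shard 451: 80 cells of regime B from `173/385` to `114/253`.
[cite: Lai2024BallRivoal, §4 Lemma 4.3] -/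
theorem shard451 :
    Shard.check 128 (2^40)
      ⟨true, 80, 173, 385, 114, 253, 16086037637480, 18890022578234⟩ = true := by
  decide +kernel

set_option maxHeartbeats 100000000 in
/-- Shard 452: 80 cells of regime B from `114/253` to `61/135`.
[cite: Lai2024BallRivoal, §4 Lemma 4.3] -/
theorem shard452 :
    Shard.check 128 (2^40)
      ⟨true, 80, 114, 253, 61, 135, 16260978047642, 19112207462156⟩ = true := by
  decide +kernel

set_option maxHeartbeats 100000000 in
/-- Shard 453: 80 cells of regime B from `61/135` to `140/309`.
[cite: Lai2024BallRivoal, §4 Lemma 4.3] -/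
theorem shard453 :
    Shard.check 128 (2^40)
      ⟨true, 80, 61, 135, 140, 309, 15758325671650, 18537497454708⟩ = true := by
  decide +kernel

set_option maxHeartbeats 100000000 in
/-- Shard 454: 80 cells of regime B from `140/309` to `149/328`.
[cite: Lai2024BallRivoal, §4 Lemma 4.3] -/
theorem shard454 :
    Shard.check 128 (2^40)
      ⟨true, 80, 140, 309, 149, 328, 15358572234103, 18082617657724⟩ = true := by
  decide +kernel

/-- The checked shards of this file, in order. [folklore] -/
def shards064 : List (CheckedShard 128 (2^40)) :=
  [⟨_, shard448⟩, ⟨_, shard449⟩, ⟨_, shard450⟩, ⟨_, shard451⟩, ⟨_, shard452⟩,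
    ⟨_, shard453⟩, ⟨_, shard454⟩]

end Summit.KontsevichZagierPeriods.Zeta5Search.Sweep
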